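import Mathlib
import HarnessLib
import HarnessLib.Audit
import Summits.Ventures.CertifiedManyBodySolver.Observables.RungLeavesCoverageHg1201P10
import Summits.Ventures.CertifiedManyBodySolver.Observables.StiffnessApexTransportCurtainTargetSlot

/-!
Route: CovHg1201M19P10

DORMANT since 2026-09-03T02:27:30Z (reconciler: no traction for 5 d (last activity item-evidence-added at 2026-08-29T01:39:51Z); parked, not closed — `ledger route dormant route-Ventures-CovHg1201M19P10 --off` to reactivate) — unstaffed, not closed; items shared with open routes are served there. `ledger route dormant <id> --off` reactivates.

# Route CovHg1201M19P10 — hubbard-cov-hg1201-P10 — certified T = 0 flux-stiffness ceiling below 0.98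
× kinematic on the Hg-1201 pressure box (M19 @ 10 GPa), owed on the residual corner patch, from the
two «L» bundles

It suffices to show X = PatchLeftEdgeP10 ∧ PatchBottomP10: on the downfolded one-band PRESSURE box
of HgBa₂CuO₄₊δ underdoped at 10 GPa (VSET M19@10,
`boxHg1201E_M19P10` = U/t ∈ [3, 17/2] × t′/t ∈ [−49/100, −7/20] × n ∈ [4/5, 22/25]) the certified
CEILING c = 0.4767609 (= 0.98 × the box kinematic
word 0.4864908, rounded down, `hg1201_M19P10_bar_arith`) on the thermodynamic-limit uniform-flux
stiffness is OWED ONLY on the RESIDUAL CORNER PATCH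
P = t′ ∈ [−49/100, −47/100] × U ∈ [3, 17/2] × n ∈ [21/25, 22/25] (7 % of the (t′, n) face; the rest
is node-free kinematics PROVED in the tree,
`hg1201M19P10_cell_of_cornerPatch` p610598 / `Hg1201M19P10_StiffnessBoxCeiling_of_cornerPatch`
p611355), and P is discharged lever-free by the «L»:
the LEFT-EDGE bundle (certified ceilings ⟨X₀(σ, U')⟩ ≤ c on torus-limit sector ground states at
(−49/100, U', n), U' ∈ [3, 17/2]) and the BOTTOM bundle
(the same for ⟨X₀(σ, 3)⟩ at (s, 3, n), s ∈ [−49/100, σ]) over target slots σ ∈ [−49/100, −47/100],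
transported to every point of P by the target-slot
theorem `ObsStiffnessSeqCeilingAt_on_box_of_bottomEdge_and_leftEdge_targetSlot` (no source outside
the box, no K₂ input). The pair gives the
registered rung leaf «MOS2-hg1201-M19P10» `Hg1201M19P10_StiffnessBoxCeiling` (alt_closer LOADED (9),
director 2026-08-28T08:00Z). This is the
@10 GPa twin of route CovHg1201M19b (same mechanism, same instrument, second parameter column); the
two columns are certified SEPARATELY and nothing is
inferred from their difference (no dT_c/dP, phase or T_c sentence; CONTROL / CALIBRATION ceilings +
labelled heuristic only).
Lean: `Summit.Ventures.CertifiedManyBodySolver.Theses.CovHg1201M19P10.PatchLeftEdgeP10 ∧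
Summit.Ventures.CertifiedManyBodySolver.Theses.CovHg1201M19P10.PatchBottomP10`

## Assembly
The tree's lever-free target-slot «L» theorem turns the two bundles (values := −c, prices trivial)
into the corner-patch cell leaf
`∀ tp ∈ [−49/100, −47/100], ∀ U ∈ [3, 17/2], ∀ n ∈ [21/25, 22/25], ObsStiffnessSeqCeilingAt tp U n
c` with c = 4767609/10⁷, and
`Hg1201M19P10_StiffnessBoxCeiling_of_cornerPatch le_rfl` (box-2 p611355 over p610598: the complement
of P is node-free kinematics below the bar)
concludes the registered leaf. The deciding theorem is `closes` in glue.lean (elaborates: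
Sketch.lean `lean check` rc 0, 0 sorry, 2026-08-28T08:58Z (pen re-check);
the same proof is `patch_of_bundles` + `closes` there).

CLOSES_TARGET: closes rung MO-S2 of Ventures/CertifiedManyBodySolver: Summit.Ventures.CertifiedManyBodySolver.Observables.Hg1201M19P10_StiffnessBoxCeiling (D-0061; not the summit Statement) — the deciding theorem of this route concludes that registered leaf (Ventures/CertifiedManyBodySolver: no summit Statement) (class rung: servable and labelled, never counted as concluding the summit Statement).

Rationale: WHY THIS LINE. The mechanism is the f-sum (odd-moment) CEILING on the flux stiffness (Kohn1964;
ScalapinoWhiteZhang1993 §II; Lipparini2008 eq. (8.30);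
HazraVermaRanderia2019 eqs. (2)–(6)): ρ_s ≤ ⟨X₀(t′, U)⟩, the kinetic combination, whose
thermodynamic-limit ground-state expectation at a TARGET
(t′, U) is bounded through the Hellmann–Feynman orbit by certified expectations of the target-slot
objective −X₀(σ, ·) at SOURCE points on the
left edge (t′ = −49/100) and the bottom (U = 3) of the patch
(`ObsStiffnessSeqCeilingAt_on_box_of_bottomEdge_and_leftEdge_targetSlot`, in tree,
lever-free), each source certified by exact rational SDP dual rows on torus-limit RDM relaxations
(claim nodes) and read over the density interval
by WN filling rows / interval adapters (the M19b adapters `covHg1201M19b_leftEdgeSegment_of_boxRow`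
p611398 are the template).
Imported from many-body sum-rule theory and convex optimisation (arXiv:2310.05844); nothing
probabilistic. What it does that prior routes do not:
the first typed PRESSURE-column obligation of any material box (Hg-1201 is the only cuprate with a
pressure leg typed in the tree,
`EmeryBoxesHg1201PHull` / `…P10Slices`); after the kinematic cover the route's entire content is
whether the own-slot corner word w″(3) at
(−49/100, 3, 22/25) and its «L» neighbours clear a bar sitting 0.56 % under exact one-body
kinematics (K = 0.47945 [float]) and ≈ 14 % above the free
value — the @0 column's corner word MEASURED c/K = 0.9707 at (−27/50, 7/2, 183/200)
(hubbard-cov-hg1201-sdp-2 «A7o2» j300184, 2026-08-28T08:40Z,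
w = 0.5036224 ≤ 0.5166800), so the instrument bites by ≈ 2.9 % where 0.56 % is needed here (captain
HG1201-COVERAGE-PLAN v0.3 §Δ5, decision node D1″).

RANKED CRUXES. #2 PatchLeftEdgeP10 (crux) — «PatchLeftEdgeP10» = the LEFT-EDGE BUNDLE of P: for
every density n ∈ [21/25, 22/25], slot σ ∈ [−49/100, −47/100] and station U' ∈ [3, 17/2], every
torus-limit sector ground state at the Hamiltonian point (t′, U, n) = (−49/100, U', n) has
D₄-averaged expectation of the target-slot f-sum objective −X₀(σ, U') at least −0.4767609, i.e. the
certified ceiling ⟨X₀(σ, U')⟩ ≤ 0.98 × the box kinematic word (own-slot corner words w″(U') = the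
case σ = −49/100; intended witness: own-slot reads at vertices U' ∈ {3, 5, 17/2} (EXT5-L⁺ parents,
corner parent «GU3n22o25tpm49o100» fired 2026-08-28T08:41Z) + PINNED-pair U-segment reads (hub =
free certificate at the small-margin end, spoke = pinned solve at the other end, captain ruling
C-S1′), density interval by a kinematic cut n ≤ n_k′ (M = 512 pair-table row at t′ = −49/100, box-2)
+ boxRow adapters; reader owner hubbard-cov-hg1201-box-1). [difficulty: L] (why it might fail: the
certified window must bite ≥ 0.56 % below exact kinematics at (−49/100, 3, 22/25); the @0 corner bit
2.9 % at U = 7/2 but the kinetic–docc coupling weakens as U decreases (∝ U² [HEUR] ⇒ ≈ 2.1 %), and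
the HF point cap at (−0.49, 3, 0.88) is not yet typed.) [HazraVermaRanderia2019,
ScalapinoWhiteZhang1993, arXiv:2205.12325, arXiv:2310.05844, KomaTasaki1994]
#3 PatchBottomP10 (crux) — «PatchBottomP10» = the BOTTOM BUNDLE of P: for every n ∈ [21/25, 22/25],
slot σ ∈ [−49/100, −47/100] and source s ∈ [−49/100, σ], every torus-limit sector ground state at
(s, 3, n) has D₄-averaged expectation of −X₀(σ, 3) at least −0.4767609 (σ-span 1/50; vertices = the
corner parent shared with PatchLeftEdgeP10 + ONE parent at (3, −47/100, 22/25) «GU3n22o25tpm47o100»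
(not yet fired), two END-objective reads per vertex and the σ-chord / pinned pair; at the inner end
s = −47/100 the exact one-body value already sits at the bar (t*′ = −0.4855 [float]) so the inner
read is near-kinematic). [difficulty: M] (why it might fail: only through its s = −49/100 end, which
IS PatchLeftEdgeP10's corner word w″(3) (needed bite 0.56 %); independently only if the inner-vertex
window at (−47/100, 3, 22/25) is slacker than ≈ 0.003 t above one-body, where kinematics gives no
margin (t*′ = −0.4855).) [HazraVermaRanderia2019, arXiv:2310.05844, KomaTasaki1994]

TWO-LAYER PLAN. Foreseen glued splits (nothing filed now): PatchLeftEdgeP10 ⇐ LeftEdgeLowUP10 (U' ∈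
[3, 5]) → LeftEdgeHighUP10 (U' ∈ [5, 17/2]) → PatchLeftEdgeP10
(glue = interval union; only if a pinned U-segment read FAILS its triangle allowance L ≤ (√m_hub +
√m_spoke)², captain ruling C-S1/C-S1′: ONE
bisection station per failed segment, never a pre-emptive ladder); the density direction n ∈ [21/25,
22/25] is first cut state-free at n_k′
(exact one-body K(−0.49, n) meets the bar at n†′ = 0.8696 [float]; candidate n_k′ = 43/50 with
margin 0.0025, box-2's M = 512 row decides) and the
strip [n_k′, 22/25] is read by the boxRow adapters (twin of p611398
`covHg1201M19b_leftEdgeSegment_of_boxRow`, density ends parametric);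
PatchBottomP10 ⇐ its two vertex END-objective families + σ-chord
(`Hg1201M19P10_StiffnessBoxCeiling_of_patchStation3_cornerObjective` shape is the
one-station insurance edition already in tree, far source −343/425 — not producible on today's caps,
citable only).

KILL CRITERIA. ROUTE-KILL witness (referee wording of the M19b twin, ADOPTED): a certified
torus-limit ground-state FLOOR on ⟨X₀(−49/100, U')⟩ (or on a target-slot
objective of the «L») ABOVE 0.4767609 at a point of P — then no f-sum / orbit-lower edition can
close there and the line as drawn is dead (pivot =
a director bar, or a content rung keyed to 0.98 × V per corner typed BESIDE the leaf) — NOT expected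
(truth at the corner ≈ V = 0.418 [EST]). ITEM
REFUTATION of PatchLeftEdgeP10 / PatchBottomP10 as typed = such a floor on the f-sum objective's
expectation (a certified kinetic-combination LOWER
bound at a doped frustrated point — no instrument of record produces one at the needed precision); a
flux-STIFFNESS floor above the bar would refute
the leaf itself and is not producible at all (StiffnessFloorInvisibleToSpectralMoments). The
REALISTIC failure is INSTRUMENTAL = decision node D1″:
the corner certificate w″(3) lands above the bar ⇒ the leaf stays OPEN, the number is banked as a
CONTROL word with its companion ratios c/F and
c/K, nothing moves; a proved PatchBottomP10 with PatchLeftEdgeP10 open moots nothing (banked as the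
bottom-bundle word).

NOT DECOMPOSED YET. The vertex parents (EXT5-L⁺ / GENONLY at (−49/100, U' ∈ {3, 5, 17/2}, 22/25) and
(−47/100, 3, 22/25); only the corner parent g5 is fired), the caps
(box-1 HF point caps by `decide +kernel` at the P10 stations — to be typed; a-priori floor
−(16211390/10⁷)·(1 + 49/100) = −2.41550), the pinned-pair
U-segment reads (algo-p2 runbook PINNED-SPOKES-RUNBOOK, Hg U-segment table entry), the n_k′
kinematic cut and the boxRow adapters, and the exact rational
certificate format are layer-2 / producer business (seats `hubbard-cov-hg1201-gen-1`, `-box-1…2`,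
`-sdp-1…2`, referee `-ref-1`, captain `-plan-1`
HG1201-COVERAGE-PLAN v0.3 72a74bdebe559cbd §Δ5); the patch P and the «L» edition are the captain's
(re-cut = re-split, not a new route). The @0 columns
(CovHg1201M19b OPEN, its M19 twin) are separate routes; the P-hull (`EmeryBoxesHg1201PHull`) is NOT
claimed — its corner word is weaker than both columns'.

CHEAPEST FALSIFIER. w″(3) = the exact −b of the own-slot corner leg at (−49/100, 3, 22/25) on the
corner parent «GU3n22o25tpm49o100» (gen-1 g5, fired 2026-08-28T08:41Z;
one sdp light pass ≈ 10 min after the parent lands ≈ 11:30Z): decision node D1″ — (i) −b ≤ 0.4767609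
⇒ proceed with the pinned «L» reads; (ii) above
⇒ the @10 corner is out of reach of window-SDP on today's caps, the leaf stays OPEN and P is
reported BY VALUE (no escalation round is pre-authorised;
a correlated cap is the only lever). Pre-registered band [HEUR, captain]: w″(3) ∈ [0.466, 0.476]
(c/K ∈ [0.972, 0.993]) — a PASS is expected but
with ≤ 1 % margin, thinner than the @0 column's 2.5 %. The U = 0 sanity (free value ≈ 0.418 and
exact one-body K = 0.47945 at the corner vs bar
0.4767609) is done [float, captain tools/kscale.py].

NUMBERS. Box kinematic word (tree, `Downfold/BoxesHg1201EP10StiffnessKinematic.lean` p610598):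
0.4864908 (M = 128 half-bathtub majorant at the binding corner
(−49/100, 22/25)); bar 0.98 × = 0.4767609 (`hg1201_M19P10_bar_arith`, D-0150 content-bar
convention); kinematic cover thresholds t* = −47/100, n* = 21/25
⇒ residual patch P = [−49/100, −47/100] × [3, 17/2] × [21/25, 22/25]; exact one-body sliver (where K
> bar) = t′ ∈ [−0.49, −0.4855] × n ∈ [0.8696, 0.88]
[float]; binding corner: exact K = 0.47945 (bar 0.56 % under it), free V ≈ 0.418 (bar ≈ 14 % above
it) — interim clause: content = below 0.98 × the
kinematic MAJORANT word; no suppression-below-free is claimed; @0 column calibration of the same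
instrument: c/K = 0.9707 at (−27/50, 7/2, 183/200)
(w = 0.5036224, j300184), CAL-HG-A c/K = 0.9804 / 0.9710 / 0.9494 for windows W = 0.312 / 0.217 /
0.137 at (−11/20, 7/2, 7/8) (j299658 / j299697 /
j299704) [certified values, float ratios]; a-priori energy floor at t′ = −49/100: −2.4154971
(`(16211390/10⁷)·(1 + |t′|)` shape, p610325 template).

DEFINITION REQUESTS. None: every notion is in tree (`ObsStiffnessSeqCeilingAt`,
`StiffnessBoxCeilingBelow`, `boxHg1201E_M19P10`, `InfVolFermionState`,
`IsGroundStateInSector`, `hubbardTorusTT'`, `oddMomentObsTT`, the target-slot «L» theorem and the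
P10 corner-patch closer).

Novelty: Searches (2026-08-28, inherited from the M19b twin's birth record + tree): `lit search --hybrid
"upper bound superfluid stiffness kinetic energy f-sum rule Hubbard model" -n 6`
([corpus:book:lipparini2008 pp. 464–465], [corpus:book:griffin1995 p. 470], [corpus:book:lieb2005 p.
169]); `lit galaxy search "superfluid stiffness bound|upper bound on the superfluid" --star pdf -n
6` ([galaxy:pdf:5090094321543315700] Leggett's bound; [galaxy:pdf:4957438413378348860]
Saslow–Galli–Reatto cond-mat/0612464); `lit search --hybrid "cuprate pressure dependence hopping t'
Hubbard parameters HgBa2CuO4" -n 6` (pressure provenance only: lit-1 dossier v1.3.1 §7.6; Wang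
2014); tree: `rg StiffnessBoxCeiling lean/Summits` (material leaves: La214 M2b, Hg1201
M19b/M19/M19P10 p611355, NdNiO₂), `ledger route show route-Ventures-CovHg1201M19b` (the @0 twin,
OPEN).
Nearest prior art found: HazraVermaRanderia2019 (PRX 9, 031049: D_s ≤ kinetic bound, float
numerics), Leggett's variational upper bound [galaxy:pdf:5090094321543315700], the programme's own
CovHg1201M19b (route-Ventures-CovHg1201M19b) and La214 obligations (arXiv:2310.05844 for the SDP
side).
Delta: the same certified sum-rule ceiling + lever-free target-slot transport, registered on the
first PRESSURE column of a material box (second parameter point of the same compound); a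
registration (crew rung route), not a mechanism.
Claimed grade: known  [refs: 2310.05844, book:lipparini2008, book:griffin1995, book:lieb2005, HazraVermaRanderia2019]

Barriers (technique_class: sdp-lower-bound, sum-rule-moment-ceiling, box-transport): - technique_class: sdp-lower-bound, sum-rule-moment-ceiling, box-transport
- Literature.Barriers.HubbardSuperconductivity.StiffnessFloorInvisibleToSpectralMoments: conceded
and irrelevant — the route claims CEILINGS only, which is exactly what finitely many moments give.
- Literature.Barriers.HubbardSuperconductivity.EnergyWindowCeilingResolution: inside its class and
load-bearing — the ceiling resolves only down to the window slack; the bet is MEASURED on the @0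
column (c/K = 0.9707 at U = 7/2 with an HF cap of window 0.22 t) and must carry to U = 3 where the
needed bite is 0.56 %; PatchLeftEdgeP10's why-might-fail is this barrier priced (decision node D1″).
- Literature.Barriers.HubbardSuperconductivity.DegreeFourSosMissesSecondOrderPerturbation: inside
its class at the corner U/t = 3 — but after the kinematic cover NO suppression below the free value
needs certifying (bar ≈ 14 % above free at the corner); it bites only through the absolute window
width, i.e. through EnergyWindowCeilingResolution.
- Literature.Barriers.HubbardSuperconductivity.SignProblemNPHard: outside its class — exact rational
dual certificates, nothing sampled.
- Literature.Barriers.HubbardSuperconductivity.OrderParameterInvisibleToGroundStateConstraints: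
conceded, irrelevant (no order-parameter floor claimed).
- Ladder ceiling (BC9): method_family=sdp sum-rule moment ceiling, box transport;
ladder_ceiling=uncapped (the window slack shrinks with relaxation level and cap quality —
EnergyWindowCeilingReso

History (route lifecycle, newest last):
- 2026-09-03T02:27:30Z · DORMANT — reconciler: no traction for 5 d (last activity item-evidence-added at 2026-08-29T01:39:51Z); parked, not closed — `ledger route dormant route-Ventures-CovHg1201 (operator:999:1110499)

sub-problem: CertifiedManyBodySolver · status: dormant · opened planner-hubbard-obs-lead-g19-0 2026-08-28T09:01:36Z · rev 0 · ledger route-Ventures-CovHg1201M19P10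
GENERATED by the gate from the ledger (D-0016/17). Provers cite these decls: `theorem foo : Summit.Ventures.CertifiedManyBodySolver.Theses.CovHg1201M19P10.<Decl> := …` in Summits/Ventures/CertifiedManyBodySolver/Theorems/<Name>.lean.
-/

namespace Summit.Ventures.CertifiedManyBodySolver.Theses.CovHg1201M19P10

open scoped BigOperators Topology Manifold Classical MeasureTheory ProbabilityTheory Matrix InnerProductSpace ComplexConjugate ContinuousMap
open Filter Set Function TopologicalSpace MeasureTheory

-- H21.Audit: Ventures rung route — no summit Statement decl; the expected conclusion is the closer leaf tagged below
attribute [summit_statement] _root_.Summit.Ventures.CertifiedManyBodySolver.Observables.Hg1201M19P10_StiffnessBoxCeiling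

/-- item stmt-Ventures-27104 · crux · rank 2 · open · by planner
why it might fail: the certified window must bite ≥ 0.56 % below exact kinematics at (−49/100, 3, 22/25); the @0 corner bit 2.9 % at U = 7/2 but the kinetic–docc coupling weakens as U decreases (∝ U² [HEUR] ⇒ ≈ 2.1 %), and the HF point cap at (−0.49, 3, 0.88) is not yet typed.
sources: HazraVermaRanderia2019, ScalapinoWhiteZhang1993, arXiv:2205.12325, arXiv:2310.05844, KomaTasaki1994
[crux] «PatchLeftEdgeP10» = the LEFT-EDGE BUNDLE of P: for every density n ∈ [21/25, 22/25], slot σ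
∈ [−49/100, −47/100] and station U' ∈ [3, 17/2], every torus-limit sector ground state at the
Hamiltonian point (t′, U, n) = (−49/100, U', n) has D₄-averaged expectation of the target-slot f-sum
objective −X₀(σ, U') at least −0.4767609, i.e. the certified ceiling ⟨X₀(σ, U')⟩ ≤ 0.98 × the box
kinematic word (own-slot corner words w″(U') = the case σ = −49/100; intended witness: own-slot
reads at vertices U' ∈ {3, 5, 17/2} (EXT5-L⁺ parents, corner parent «GU3n22o25tpm49o100» fired
2026-08-28T08:41Z) + PINNED-pair U-segment reads (hub = free certificate at the small-margin end,
spoke = pinned solve at the other end, captain ruling C-S1′), density interval by a kinematic cut n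
≤ n_k′ (M = 512 pair-table row at t′ = −49/100, box-2) + boxRow adapters; reader owner
hubbard-cov-hg1201-box-1). [difficulty: L] -/
@[route_item "route-Ventures-CovHg1201M19P10"]
def PatchLeftEdgeP10 : Prop :=
  ∀ n ∈ Set.Icc (21 / 25 : ℝ) (22 / 25), ∀ σ ∈ Set.Icc (-49 / 100 : ℝ) (-47 / 100), ∀ U' ∈ Set.Icc (3 : ℝ) (17 / 2), ∀ (ω : Literature.MathematicalPhysics.QuantumLattice.InfVolFermionState 2) (Ls : ℕ → ℕ) (ψ : ∀ L, Literature.MathematicalPhysics.QuantumLattice.Fock (Literature.MathematicalPhysics.QuantumLattice.Orb (Literature.MathematicalPhysics.QuantumLattice.FermionTorus 2 L))), Filter.Tendsto Ls Filter.atTop Filter.atTop → (∀ j, Literature.MathematicalPhysics.QuantumLattice.IsGroundStateInSector (Literature.MathematicalPhysics.QuantumLattice.hubbardTorusTT' (Ls j) 1 (-49 / 100) U') (Literature.MathematicalPhysics.QuantumLattice.ThermodynamicLimit.rectN n (Ls j)) 0 (ψ (Ls j))) → (∀ j, star (ψ (Ls j)) ⬝ᵥ ψ (Ls j) = 1) →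 ω.IsTorusLimitOf ψ Ls → -(4767609 / 10000000 : ℝ) ≤ ((Finset.univ : Finset (DihedralGroup 4)).card : ℝ)⁻¹ * ∑ g ∈ (Finset.univ : Finset (DihedralGroup 4)), (ω.expect (Literature.MathematicalPhysics.QuantumLattice.d4ShiftSet g 0 (Literature.Probability.LatticeModels.box 2 7)) (Literature.MathematicalPhysics.QuantumLattice.fermionEmbed (Literature.MathematicalPhysics.QuantumLattice.PolySite.d4Emb g 0 (Literature.Probability.LatticeModels.box 2 7)) (-Summit.Ventures.CertifiedManyBodySolver.Observables.oddMomentObsTT σ U' 0))).re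

/-- item stmt-Ventures-27105 · crux · rank 3 · open · by planner
why it might fail: only through its s = −49/100 end, which IS PatchLeftEdgeP10's corner word w″(3) (needed bite 0.56 %); independently only if the inner-vertex window at (−47/100, 3, 22/25) is slacker than ≈ 0.003 t above one-body, where kinematics gives no margin (t*′ = −0.4855).
sources: HazraVermaRanderia2019, arXiv:2310.05844, KomaTasaki1994
[crux] «PatchBottomP10» = the BOTTOM BUNDLE of P: for every n ∈ [21/25, 22/25], slot σ ∈ [−49/100,
−47/100] and source s ∈ [−49/100, σ], every torus-limit sector ground state at (s, 3, n) has
D₄-averaged expectation of −X₀(σ, 3) at least −0.4767609 (σ-span 1/50; vertices = the corner parent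
shared with PatchLeftEdgeP10 + ONE parent at (3, −47/100, 22/25) «GU3n22o25tpm47o100» (not yet
fired), two END-objective reads per vertex and the σ-chord / pinned pair; at the inner end s =
−47/100 the exact one-body value already sits at the bar (t*′ = −0.4855 [float]) so the inner read
is near-kinematic). [difficulty: M] -/
@[route_item "route-Ventures-CovHg1201M19P10"]
def PatchBottomP10 : Prop :=
  ∀ n ∈ Set.Icc (21 / 25 : ℝ) (22 / 25), ∀ σ ∈ Set.Icc (-49 / 100 : ℝ) (-47 / 100), ∀ s ∈ Set.Icc (-49 / 100 : ℝ) σ, ∀ (ω : Literature.MathematicalPhysics.QuantumLattice.InfVolFermionState 2) (Ls : ℕ → ℕ) (ψ : ∀ L, Literature.MathematicalPhysics.QuantumLattice.Fock (Literature.MathematicalPhysics.QuantumLattice.Orb (Literature.MathematicalPhysics.QuantumLattice.FermionTorus 2 L))), Filter.Tendsto Ls Filter.atTop Filter.atTop → (∀ j, Literature.MathematicalPhysics.QuantumLattice.IsGroundStateInSector (Literature.MathematicalPhysics.QuantumLattice.hubbardTorusTT' (Ls j) 1 s 3) (Literature.MathematicalPhysics.QuantumLattice.ThermodynamicLimit.rectN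 n (Ls j)) 0 (ψ (Ls j))) → (∀ j, star (ψ (Ls j)) ⬝ᵥ ψ (Ls j) = 1) → ω.IsTorusLimitOf ψ Ls → -(4767609 / 10000000 : ℝ) ≤ ((Finset.univ : Finset (DihedralGroup 4)).card : ℝ)⁻¹ * ∑ g ∈ (Finset.univ : Finset (DihedralGroup 4)), (ω.expect (Literature.MathematicalPhysics.QuantumLattice.d4ShiftSet g 0 (Literature.Probability.LatticeModels.box 2 7)) (Literature.MathematicalPhysics.QuantumLattice.fermionEmbed (Literature.MathematicalPhysics.QuantumLattice.PolySite.d4Emb g 0 (Literature.Probability.LatticeModels.box 2 7)) (-Summit.Ventures.CertifiedManyBodySolver.Observables.oddMomentObsTT σ 3 0))).re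

/-- item stmt-Ventures-27106 · assembly · rank 1 · closed · proved by Summit.Ventures.CertifiedManyBodySolver.Theorems.covHg1201M19P10Assembly_proof (prover) · by planner
sources: ScalapinoWhiteZhang1993, KomaTasaki1994
[assembly] PatchLeftEdgeP10 → PatchBottomP10 → the rung leaf Hg1201M19P10_StiffnessBoxCeiling -/
@[route_item "route-Ventures-CovHg1201M19P10"]
def Assembly : Prop :=
  Summit.Ventures.CertifiedManyBodySolver.Theses.CovHg1201M19P10.PatchLeftEdgeP10 → Summit.Ventures.CertifiedManyBodySolver.Theses.CovHg1201M19P10.PatchBottomP10 → Summit.Ventures.CertifiedManyBodySolver.Observables.Hg1201M19P10_StiffnessBoxCeiling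

-- `Assembly` holds: proved by `Summit.Ventures.CertifiedManyBodySolver.Theorems.covHg1201M19P10Assembly_proof` (its module imports this route file, so no `_holds` link can be stated here).

/-! D-0027 §2.1 — DECIDING THEOREM (planner-authored via `route open/edit --closes-file`; by planner-hubbard-obs-lead-g19-0 2026-08-28T09:01:36Z):
its hypotheses are this route's items and its conclusion the registered leaf `Summit.Ventures.CertifiedManyBodySolver.Observables.Hg1201M19P10_StiffnessBoxCeiling` (rung MO-S2, D-0061) (glue_lint), and it elaborates with this file. -/

@[closes "route-Ventures-CovHg1201M19P10"] theorem closes (h₁ : PatchLeftEdgeP10) (h₂ : PatchBottomP10) :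
    Summit.Ventures.CertifiedManyBodySolver.Observables.Hg1201M19P10_StiffnessBoxCeiling :=
  Summit.Ventures.CertifiedManyBodySolver.Observables.Hg1201M19P10_StiffnessBoxCeiling_of_cornerPatch le_rfl
    fun tp htp U hU n hn =>
      Summit.Ventures.CertifiedManyBodySolver.Observables.ObsStiffnessSeqCeilingAt_on_box_of_bottomEdge_and_leftEdge_targetSlot
        (p := -49 / 100) (q := -47 / 100) (UA := 3) (Umax := 17 / 2) (n := n)
        (by norm_num) (by norm_num) (by norm_num) (by linarith [hn.1]) (by linarith [hn.2])
        (fun _ _ => -(4767609 / 10000000 : ℝ)) (fun _ _ => -(4767609 / 10000000 : ℝ)) (4767609 / 10000000)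
        (fun σ hσ s hs => h₂ n hn σ hσ s hs) (fun σ _ s _ => by norm_num) (fun σ hσ U' hU' => h₁ n hn σ hσ U' hU')
        (fun σ _ U' _ => by norm_num) tp htp U hU

end Summit.Ventures.CertifiedManyBodySolver.Theses.CovHg1201M19P10
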